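import Mathlib
import Summits.NavierStokesRegularity.NavierStokesRegularity.Theorems.SubOnsagerCeilingKPSideBranchClassTenSteps
import Literature.Analysis.ODE.MaximalTime
import HarnessLib

/-!
# ν-uniform envelopes for the side-branch class of KP networks proper on `b ∈ [89/50, 2]` with HALF the pump
# (damping slack `1/10`) — the bootstrap (helper file for crux stmt-NavierStokesRegularity-27057
`SubOnsagerCeiling.ForwardTailCeilingKP`, `--supports … --as helper`; LEAD SOC census v9 §G.1 / tenure successor item (1))

`sideClass_envelopes_ten`: verbatim LEAD g5's `sideClass_envelopes` (sibling `SubOnsagerCeilingKPSideBranchClassEnvelopes`,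
`b ∈ [1.9, 2]`) on the wider ratio range `ε₀ ∈ [39/50, 1]` under the halved class conditions `13P² < f²κ⁴`,
`10Pκb^{5/2} ≤ c₀b^{2θ}`, `Pb^{5/2} ≤ c₀b^{2θ}`: along EVERY honest non-negative `ν`-viscous solution from a one-shell
datum `X₀` (all four components, signed), for every `ν > 0`, with `E₀ = Σ_j ½X₀_j²`,
`b^{2θk} X_{0,k}(t)² ≤ 200 E₀` (all `k ≥ 0`) and `b^{2θk} X_{1,k}(t)² ≤ 200 κ² E₀` (all `k ≥ 1`), `θ = 101/200`.
Proof = the same maximal-time bootstrap with the steps `sideClass_chainEnv_ten` / `sideClass_sideStrict_ten`.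

HONEST FRAMING: a theorem about Tao-type MODEL lattice tables (rung under crux `ForwardTailCeilingKP`, route
SubOnsagerCeiling, TL-M2Break): forward sources of one architecture class on one ratio range, ν-uniformly enveloped at
`θ > 1/2`; the total tail (with the pocket) is NOT claimed (25507's refutation); nothing here bears on Navier–Stokes
regularity; 27057 stays OPEN.
-/

noncomputable section

-- the sub-problem namespace `NavierStokesRegularity.NavierStokesRegularity` is the tree's layout (D-0017)
set_option linter.dupNamespace false

namespace Summit.NavierStokesRegularity.NavierStokesRegularity.Theorems

open Set Filter Topology
open Literature.Analysis.FluidPDE.TaoCascade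
open Summit.NavierStokesRegularity.NavierStokesRegularity.Theorems.DyadicRange

/-- **ν-UNIFORM ENVELOPES FOR THE SIDE-BRANCH CLASS, `b ∈ [89/50, 2]`, halved pump** (see the module docstring). MODEL lattice statement.
[this file] -/
theorem sideClass_envelopes_ten {ε₀ ν s c₀ P f κ : ℝ} {α : Fin 4 → Fin 4 → Fin 4 → ℤ × ℤ × ℤ → ℝ}
    {X₀ : Fin 4 → ℝ} {X : Fin 4 → ℤ → ℝ → ℝ}
    (hε : 39 / 50 ≤ ε₀) (hε1 : ε₀ ≤ 1) (hν : 0 < ν) (hs : 0 < s)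
    (hsy : IsSymmetricCoeff α) (hc : IsCancellingCoeff α)
    (hO : ∀ (Y : Fin 4 → ℤ → ℝ → ℝ) (τ : ℝ), (∀ (j : Fin 4) (k : ℤ), 1 ≤ k → 0 ≤ Y j k τ) →
      ∀ δ : ℝ, 0 < δ → ∀ (i : Fin 4) (n : ℤ), 1 ≤ n → Y i n τ = 0 → 0 ≤ quadTerm δ α Y i n τ)
    (hD : ∀ a b i : Fin 4, a ≠ b → α a b i (0, 0, 1) = 0)
    (hw : ∀ a c : Fin 4, α a a c (0, 0, 1) = (if a = 0 ∧ c = 0 then c₀ else 0) + (if a = 1 ∧ c = 2 then f else 0))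
    (hP : ∀ a c : Fin 4, a ≠ c → α a a c (0, 0, 0) = if a = 0 ∧ c = 1 then P else 0)
    (hCz : ∀ a b c : Fin 4, a ≠ b → a ≠ c → b ≠ c → α a b c (0, 0, 0) = 0)
    (hc₀ : 0 < c₀) (hP0 : 0 ≤ P) (hf : 0 < f) (hκ : 0 < κ)
    (hpair : 13 * P ^ 2 < f ^ 2 * κ ^ 4)
    (hdrain : 10 * P * κ * (1 + ε₀) ^ ((5 : ℝ) / 2) ≤ c₀ * ((1 + ε₀) ^ ((101 : ℝ) / 200)) ^ 2)
    (hP1 : P * (1 + ε₀) ^ ((5 : ℝ) / 2) ≤ c₀ * ((1 + ε₀) ^ ((101 : ℝ) / 200)) ^ 2)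
    (hX0 : ∀ (i : Fin 4) (k : ℤ), X i k 0 = if k = 0 then X₀ i else 0)
    (hvan : ∀ (i : Fin 4) (k : ℤ), k < 0 → ∀ t : ℝ, X i k t = 0)
    (hbdd : ∃ M : ℝ, ∀ (t : ℝ) (i : Fin 4) (k : ℤ), (1 + (1 + ε₀) ^ ((10 : ℝ) * k)) * |X i k t| ≤ M)
    (hXc : ∀ (i : Fin 4) (k : ℤ), Continuous (X i k))
    (hode : ∀ (i : Fin 4) (k : ℤ), ∀ t ∈ Icc (0 : ℝ) s, HasDerivWithinAt (X i k)
      (quadTerm ε₀ α X i k t - ν * (1 + ε₀) ^ ((2 : ℝ) * k) * X i k t) (Icc (0 : ℝ) s) t)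
    (hnn : ∀ t ∈ Icc (0 : ℝ) s, ∀ (i : Fin 4) (k : ℤ), 1 ≤ k → 0 ≤ X i k t) :
    ∀ t ∈ Icc (0 : ℝ) s,
      (∀ k : ℕ, ((1 + ε₀) ^ ((101 : ℝ) / 200)) ^ (2 * k) * X 0 (k : ℤ) t ^ 2 ≤
          200 * ∑ j : Fin 4, (1 / 2 : ℝ) * X₀ j ^ 2) ∧
      (∀ k : ℕ, 1 ≤ k → ((1 + ε₀) ^ ((101 : ℝ) / 200)) ^ (2 * k) * X 1 (k : ℤ) t ^ 2 ≤
          200 * κ ^ 2 * ∑ j : Fin 4, (1 / 2 : ℝ) * X₀ j ^ 2) := by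
  have hε0 : 0 < ε₀ := by linarith
  have hb0 : (0 : ℝ) < 1 + ε₀ := by linarith
  have hb1 : (1 : ℝ) ≤ 1 + ε₀ := by linarith
  set B₁ : ℝ := (1 + ε₀) ^ ((101 : ℝ) / 200) with hB₁
  have hB₁0 : 0 < B₁ := Real.rpow_pos_of_pos hb0 _
  set E₀ : ℝ := ∑ j : Fin 4, (1 / 2 : ℝ) * X₀ j ^ 2 with hE₀
  have hE₀0 : 0 ≤ E₀ := Finset.sum_nonneg fun j _ => by positivity
  set Eb : ℝ := Real.sqrt (2 * E₀) with hEb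
  have hEb0 : 0 ≤ Eb := Real.sqrt_nonneg _
  have hEb2 : Eb ^ 2 = 2 * E₀ := Real.sq_sqrt (by positivity)
  obtain ⟨M, hM⟩ := hbdd
  -- (i) energy: every mode is bounded by `Ē`
  have hmode : ∀ t ∈ Icc (0 : ℝ) s, ∀ (i : Fin 4) (k : ℕ), |X i (k : ℤ) t| ≤ Eb := by
    intro t ht i k
    have h := sideClass_mode_le_energy hε0 hν hc hX0 hvan hM hode ht i k
    have h2 : X i (k : ℤ) t ^ 2 ≤ Eb ^ 2 := by rw [hEb2]; linarith
    exact abs_le_of_sq_le_sq h2 hEb0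
  have hE00 : ∀ t ∈ Icc (0 : ℝ) s, |X 0 0 t| ≤ Eb := fun t ht => by simpa using hmode t ht 0 0
  have hE10 : ∀ t ∈ Icc (0 : ℝ) s, |X 1 0 t| ≤ Eb := fun t ht => by simpa using hmode t ht 1 0
  -- the degenerate case `Ē = 0`
  rcases eq_or_lt_of_le hEb0 with hEbz | hEbpos
  · have hzero : ∀ t ∈ Icc (0 : ℝ) s, ∀ (i : Fin 4) (k : ℕ), X i (k : ℤ) t = 0 := by
      intro t ht i k
      have := hmode t ht i k
      rw [← hEbz] at this
      exact abs_eq_zero.1 (le_antisymm this (abs_nonneg _))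
    intro t ht
    refine ⟨fun k => ?_, fun k _ => ?_⟩
    · rw [hzero t ht 0 k]; simp only [ne_eq, OfNat.ofNat_ne_zero, not_false_eq_true, zero_pow, mul_zero]
      positivity
    · rw [hzero t ht 1 k]; simp only [ne_eq, OfNat.ofNat_ne_zero, not_false_eq_true, zero_pow, mul_zero]
      positivity
  -- (ii) the tail of the side component is controlled by the weight bound
  have hbt : 0 < (1 + ε₀) ^ (10 : ℝ) := Real.rpow_pos_of_pos hb0 _
  set q : ℝ := B₁ / (1 + ε₀) ^ (10 : ℝ) with hq
  have hq0 : 0 ≤ q := by positivity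
  have hq1 : q < 1 := by
    rw [hq, div_lt_one hbt, hB₁]
    exact Real.rpow_lt_rpow_of_exponent_lt (by linarith) (by norm_num)
  have hM0 : 0 ≤ M := le_trans (mul_nonneg (by positivity) (abs_nonneg _)) (hM 0 0 0)
  have hside_w : ∀ (k : ℕ) (t : ℝ), B₁ ^ k * X 1 (k : ℤ) t ≤ M * q ^ k := by
    intro k t
    have h := hM t 1 (k : ℤ)
    have e : (1 + ε₀) ^ ((10 : ℝ) * ((k : ℤ) : ℝ)) = ((1 + ε₀) ^ (10 : ℝ)) ^ k := by
      rw [← Real.rpow_mul_natCast hb0.le]; push_cast; ring_nf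
    rw [e] at h
    have h0 : 0 ≤ |X 1 (k : ℤ) t| := abs_nonneg _
    have h1 : ((1 + ε₀) ^ (10 : ℝ)) ^ k * |X 1 (k : ℤ) t| ≤ M := by nlinarith [pow_nonneg hbt.le k]
    have h2 : B₁ ^ k * X 1 (k : ℤ) t ≤ B₁ ^ k * |X 1 (k : ℤ) t| :=
      mul_le_mul_of_nonneg_left (le_abs_self _) (pow_nonneg hB₁0.le k)
    have h3 : B₁ ^ k * |X 1 (k : ℤ) t| = q ^ k * (((1 + ε₀) ^ (10 : ℝ)) ^ k * |X 1 (k : ℤ) t|) := by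
      rw [hq, div_pow]; field_simp
    rw [h3] at h2
    have h4 : q ^ k * (((1 + ε₀) ^ (10 : ℝ)) ^ k * |X 1 (k : ℤ) t|) ≤ q ^ k * M :=
      mul_le_mul_of_nonneg_left h1 (pow_nonneg hq0 k)
    linarith
  have hκE : 0 < κ * Eb := mul_pos hκ hEbpos
  obtain ⟨K₀, hK₀⟩ := geometric_tail_small hq0 hq1 (show 0 ≤ M / (κ * Eb) by positivity)
  have htail : ∀ k : ℕ, K₀ ≤ k → ∀ t : ℝ, B₁ ^ k * X 1 (k : ℤ) t ≤ 10 * κ * Eb := by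
    intro k hk t
    have h1 := hside_w k t
    have h2 := hK₀ k hk
    rw [div_mul_eq_mul_div, div_le_iff₀ hκE] at h2
    nlinarith
  -- the bootstrap predicate: the side envelope on the first `K₀` shells
  set Q : ℝ → Prop := fun t => ∀ k ∈ Finset.Icc 1 K₀, B₁ ^ k * X 1 (k : ℤ) t ≤ 10 * κ * Eb with hQ
  have hQ0 : Q 0 := by
    intro k hk
    have hk1 := (Finset.mem_Icc.1 hk).1
    have : X 1 (k : ℤ) 0 = 0 := by
      rw [hX0, if_neg (by exact_mod_cast (by omega : k ≠ 0))]
    rw [this, mul_zero]; positivity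
  have hcontB : ∀ k : ℕ, Continuous fun t => B₁ ^ k * X 1 (k : ℤ) t := fun k =>
    continuous_const.mul (hXc 1 k)
  have hclosed : ∀ t ∈ Ioc (0 : ℝ) s, (∀ r ∈ Ico (0 : ℝ) t, Q r) → Q t := by
    intro t ht hQr k hk
    exact Literature.Barriers.NavierStokesRegularity.Dyadic.le_of_forall_Ico_le
      (hcontB k).continuousOn continuousOn_const ht fun r hr => hQr r hr k hk
  -- from `Q` on a window and the tail: the side envelope on all shells there
  have sideEnv_of_Q : ∀ T' : ℝ, (∀ t ∈ Icc (0 : ℝ) T', Q t) →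
      ∀ k : ℕ, 1 ≤ k → ∀ t ∈ Icc (0 : ℝ) T', B₁ ^ k * X 1 (k : ℤ) t ≤ 10 * κ * Eb := by
    intro T' hQT k hk t ht
    rcases le_or_gt K₀ k with hK | hK
    · exact htail k hK t
    · exact hQT t ht k (Finset.mem_Icc.2 ⟨hk, hK.le⟩)
  -- chain envelope on a window `[0,T']`, `0 ≤ T' ≤ s`, from the side envelope there
  have chainEnv : ∀ T' : ℝ, 0 ≤ T' → T' ≤ s →
      (∀ k : ℕ, 1 ≤ k → ∀ t ∈ Icc (0 : ℝ) T', B₁ ^ k * X 1 (k : ℤ) t ≤ 10 * κ * Eb) →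
      ∀ t ∈ Icc (0 : ℝ) T', ∀ k : ℕ, B₁ ^ (2 * k) * X 0 (k : ℤ) t ^ 2 ≤ 100 * Eb ^ 2 := by
    intro T' hT'0 hT's hside t ht k
    rcases eq_or_lt_of_le hT'0 with hT'z | hT'pos
    · -- `T' = 0`: the datum
      have ht0 : t = 0 := le_antisymm (hT'z ▸ ht.2) ht.1
      subst ht0
      rcases Nat.eq_zero_or_pos k with hk0 | hk
      · subst hk0
        have h := hE00 0 ⟨le_rfl, hs.le⟩
        have h2 : X 0 0 0 ^ 2 ≤ Eb ^ 2 := by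
          rw [← sq_abs]; exact pow_le_pow_left₀ (abs_nonneg _) h 2
        simp only [Nat.cast_zero, mul_zero, pow_zero, one_mul]
        nlinarith
      · rw [hX0, if_neg (by exact_mod_cast (by omega : k ≠ 0))]
        simp only [ne_eq, OfNat.ofNat_ne_zero, not_false_eq_true, zero_pow, mul_zero]
        positivity
    · exact sideClass_chainEnv_ten hε hε1 hν hsy hc hO hD hw hP hCz hc₀ hP0 hdrain hP1 hX0 hvan hM hXc hode hnn
        hEb0 hE00 hE10 hT'pos hT's hside t ht k
  -- strict side envelope on `[0,T']` from the side envelope there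
  have strict : ∀ T' : ℝ, 0 ≤ T' → T' ≤ s →
      (∀ k : ℕ, 1 ≤ k → ∀ t ∈ Icc (0 : ℝ) T', B₁ ^ k * X 1 (k : ℤ) t ≤ 10 * κ * Eb) →
      ∀ k : ℕ, 1 ≤ k → ∀ t ∈ Icc (0 : ℝ) T', B₁ ^ k * X 1 (k : ℤ) t < 10 * κ * Eb := by
    intro T' hT'0 hT's hside k hk
    have hBk : 0 < B₁ ^ k := pow_pos hB₁0 k
    have hchain : ∀ τ ∈ Icc (0 : ℝ) T', X 0 (k : ℤ) τ ^ 2 ≤ (10 * Eb / B₁ ^ k) ^ 2 := by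
      intro τ hτ
      have h := chainEnv T' hT'0 hT's hside τ hτ k
      rw [div_pow, le_div_iff₀ (pow_pos hBk 2)]
      calc X 0 (k : ℤ) τ ^ 2 * (B₁ ^ k) ^ 2 = B₁ ^ (2 * k) * X 0 (k : ℤ) τ ^ 2 := by ring
        _ ≤ 100 * Eb ^ 2 := h
        _ = (10 * Eb) ^ 2 := by ring
    exact sideClass_sideStrict_ten hε0 hε1 hν hsy hc hO hD hw hP hCz hP0 hf hκ hpair hX0 hode hnn hEbpos hT's hk hchain
  -- (v) the maximal time of `Q` is `s`
  have hQall : ∀ t ∈ Icc (0 : ℝ) s, Q t := by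
    set T := Literature.Analysis.ODE.maximalTimeP Q 0 s with hT
    have hTmem : T ∈ Icc (0 : ℝ) s := Literature.Analysis.ODE.maximalTimeP_mem hs.le hQ0
    have hQT : ∀ t ∈ Icc (0 : ℝ) T, Q t := fun t ht =>
      Literature.Analysis.ODE.maximalTimeP_spec hs.le hQ0 hclosed ht
    by_contra hall
    have hTb : T < s := by
      rcases lt_or_eq_of_le hTmem.2 with hlt | heq
      · exact hlt
      · exact absurd (fun t ht => hQT t (heq ▸ ht)) hall
    have hside := sideEnv_of_Q T hQT
    have hstrict := strict T hTmem.1 hTb.le hside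
    have hright : ∀ᶠ t in 𝓝[Ici T] T, Q t := by
      have ev : ∀ k ∈ Finset.Icc 1 K₀, ∀ᶠ t in 𝓝[Ici T] T, B₁ ^ k * X 1 (k : ℤ) t ≤ 10 * κ * Eb := by
        intro k hk
        have hk1 := (Finset.mem_Icc.1 hk).1
        have hlt := hstrict k hk1 T ⟨hTmem.1, le_rfl⟩
        have hcw : ContinuousWithinAt (fun t => B₁ ^ k * X 1 (k : ℤ) t) (Ici T) T :=
          (hcontB k).continuousAt.continuousWithinAt
        exact (hcw.eventually_lt_const hlt).mono fun t ht => ht.le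
      exact (Filter.eventually_all_finset _).2 ev
    exact Literature.Analysis.ODE.not_eventually_of_maximalTimeP_lt hs.le hQ0 hTb
      (Literature.Barriers.NavierStokesRegularity.Dyadic.eventually_nhdsWithin_Icc_of_left_of_right hQT hright)
  -- conclusion
  have hsideAll := sideEnv_of_Q s hQall
  have hchainAll := chainEnv s hs.le le_rfl hsideAll
  intro t ht
  refine ⟨fun k => ?_, fun k hk => ?_⟩
  · have h := hchainAll t ht k
    rw [hEb2] at h; linarith
  · have h1 := hsideAll k hk t ht
    have h0 : 0 ≤ B₁ ^ k * X 1 (k : ℤ) t :=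
      mul_nonneg (pow_nonneg hB₁0.le k) (hnn t ht 1 k (by exact_mod_cast hk))
    have h2 : (B₁ ^ k * X 1 (k : ℤ) t) ^ 2 ≤ (10 * κ * Eb) ^ 2 := pow_le_pow_left₀ h0 h1 2
    calc B₁ ^ (2 * k) * X 1 (k : ℤ) t ^ 2 = (B₁ ^ k * X 1 (k : ℤ) t) ^ 2 := by ring
      _ ≤ (10 * κ * Eb) ^ 2 := h2
      _ = 200 * κ ^ 2 * E₀ := by
          rw [show (10 * κ * Eb) ^ 2 = 100 * κ ^ 2 * Eb ^ 2 by ring, hEb2]; ring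

end Summit.NavierStokesRegularity.NavierStokesRegularity.Theorems

end
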